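import Summits.AtomisticToContinuum.HydrodynamicLimit.Theorems.RelayRaceLocalityNearConstantShortTimeHLTiltL2Defs
import HarnessLib

/-!
# Crux `NearConstantShortTimeHL` (stmt-AtomisticToContinuum-12502), line `small-tilt-domination`:
# the cluster limit with a rate (`CoefRateNonneg`, stub `tl_coefRateNonneg`)

The quantitative twin of the tree's `tendsto_choose_sub_mul_Wd` (`HardSphereCanonicalTorus`): at a FIXED
scale `ε > 0` with `j ε < 1/4` and a fixed particle number `n ≥ j + 1`, for a profile `P` whose density
`β` is `L`-Lipschitz and a bounded measurable decoration `|g| ≤ C`,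

  `|C(n-1-s, j) W^g_{ε,n}(j+1) - γ_j ∫ g β^{j+1}|`
  `≤ C Θ_j (|C(n-1-s, j) ε^{3j} - σ^{3j}/j!| (1+M)^j + |σ³|^j (1+M)^j L ε)`,

with the explicit `Θ_j = B_j V_j (j+1)²` (`B_j = hcUrsellBound` of `j+1` labels, `V_j` the volume of the
support box `{‖zᵢ‖ ≤ j}` of the unit-scale lifted Ursell function).

Proof: the exact scaling identity `W^g(j+1) = ε^{3j} ∫ g β J_ε` (`Wd_eq_Wd_self`, `Wd_self_eq_pow_mul`),
`γ_j = σ^{3j} b_j / j!`, the split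
`C W - γ ∫gβ^{j+1} = (C ε^{3j} - σ^{3j}/j!) ∫ gβJ_ε + (σ^{3j}/j!) ∫ gβ (J_ε - b_j β^j)`,
`|J_ε| ≤ ∫ domF = B_j M^j V_j`, and the Lipschitz estimate
`|J_ε(y₀) - b_j β(y₀)^j| ≤ B_j V_j j² (1+M)^j L ε` (on the support `‖zᵢ‖ ≤ j` one has
`|β(y₀ + proj(ε zᵢ)) - β(y₀)| ≤ L ‖ε zᵢ‖ ≤ L ε j`, and `|∏ aᵢ - ∏ bᵢ| ≤ j A^j max |aᵢ - bᵢ|` for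
`|aᵢ|, |bᵢ| ≤ A`, `A = 1 + M ≥ 1`).

NOTE. The original `CoefRate` quantifies over ALL real `σ` with the last majorant term
`(σ^3)^j (1+M)^j L ε`, which is negative for `σ < 0`, `j` odd, and is then false (constant profile,
`j = 1`, `σ = -1`, `L` large). The statement proved here is the repaired `CoefRateNonneg` (`0 ≤ σ`, the
only case used downstream: `σ` is a reduced diameter), via the absolute-value form `tlc_coefRate_abs`
valid for every real `σ` (`|σ³|^j` in the last term).
-/

noncomputable section

namespace Summit.AtomisticToContinuum.HydrodynamicLimit.Theorems.NearConstantShortTimeHL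

open MeasureTheory Finset
open Literature.MathematicalPhysics.KineticTheory Literature.MathematicalPhysics.StatisticalMechanics
open Literature.Probability.LatticeModels
open Literature.Analysis.FunctionSpaces.Torus (proj norm_proj_le proj_zero)

/-! ### Elementary lemmas -/

/-- A Lipschitz bound `|β x - β y| ≤ L · dist x y` on the (non-trivial) torus forces `0 ≤ L`. [folklore] -/
theorem tlc_lip_nonneg (P : DensityProfile) {L : ℝ} (h : ∀ x y, |P.β x - P.β y| ≤ L * dist x y) :
    0 ≤ L := by
  set x1 : T3 := fun _ => ((1 / 2 : ℝ) : UnitAddCircle) with hx1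
  have hne : x1 ≠ 0 := by
    intro h0
    have h1 : ((1 / 2 : ℝ) : UnitAddCircle) = 0 := congr_fun h0 0
    rw [AddCircle.coe_eq_zero_iff] at h1
    obtain ⟨n, hn⟩ := h1
    rw [zsmul_eq_mul, mul_one] at hn
    have h2 : (2 * n : ℝ) = 1 := by linarith
    have h3 : (2 * n : ℤ) = 1 := by exact_mod_cast h2
    omega
  have hd : 0 < dist x1 0 := dist_pos.2 hne
  by_contra hL
  have h4 := h x1 0
  have h5 : L * dist x1 0 < 0 := mul_neg_of_neg_of_pos (not_le.mp hL) hd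
  linarith [abs_nonneg (P.β x1 - P.β 0)]

/-- Products of bounded factors are Lipschitz in the factors:
`|∏ fᵢ - ∏ gᵢ| ≤ |s| · A^{|s|} · δ` if `|fᵢ|, |gᵢ| ≤ A`, `A ≥ 1`, `|fᵢ - gᵢ| ≤ δ`. [folklore] -/
theorem tlc_abs_prod_sub_prod_le {ι : Type*} [DecidableEq ι] (s : Finset ι) (f g : ι → ℝ) {A δ : ℝ}
    (hA : 1 ≤ A) (hδ : 0 ≤ δ) (hf : ∀ i ∈ s, |f i| ≤ A) (hg : ∀ i ∈ s, |g i| ≤ A)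
    (hfg : ∀ i ∈ s, |f i - g i| ≤ δ) :
    |∏ i ∈ s, f i - ∏ i ∈ s, g i| ≤ s.card * A ^ s.card * δ := by
  induction s using Finset.induction_on with
  | empty => simp
  | @insert a s has ih =>
    rw [Finset.prod_insert has, Finset.prod_insert has, Finset.card_insert_of_notMem has]
    have hfa : |f a| ≤ A := hf a (mem_insert_self a s)
    have hfga : |f a - g a| ≤ δ := hfg a (mem_insert_self a s)
    have ih' : |∏ i ∈ s, f i - ∏ i ∈ s, g i| ≤ s.card * A ^ s.card * δ :=
      ih (fun i hi => hf i (mem_insert_of_mem hi)) (fun i hi => hg i (mem_insert_of_mem hi))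
        (fun i hi => hfg i (mem_insert_of_mem hi))
    have hPg : |∏ i ∈ s, g i| ≤ A ^ s.card := by
      rw [Finset.abs_prod]
      calc ∏ i ∈ s, |g i| ≤ ∏ _i ∈ s, A :=
            Finset.prod_le_prod (fun i _ => abs_nonneg _) (fun i hi => hg i (mem_insert_of_mem hi))
        _ = A ^ s.card := Finset.prod_const A
    have key : f a * ∏ i ∈ s, f i - g a * ∏ i ∈ s, g i =
        f a * (∏ i ∈ s, f i - ∏ i ∈ s, g i) + (f a - g a) * ∏ i ∈ s, g i := by ring
    rw [key]
    have hA0 : 0 ≤ A := by linarith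
    have hAn : 0 ≤ A ^ s.card := pow_nonneg hA0 _
    calc |f a * (∏ i ∈ s, f i - ∏ i ∈ s, g i) + (f a - g a) * ∏ i ∈ s, g i|
        ≤ |f a| * |∏ i ∈ s, f i - ∏ i ∈ s, g i| + |f a - g a| * |∏ i ∈ s, g i| :=
          (abs_add_le _ _).trans (by rw [abs_mul, abs_mul])
      _ ≤ A * (s.card * A ^ s.card * δ) + δ * A ^ s.card :=
          add_le_add (mul_le_mul hfa ih' (abs_nonneg _) hA0) (mul_le_mul hfga hPg (abs_nonneg _) hδ)
      _ ≤ ((s.card + 1 : ℕ) : ℝ) * A ^ (s.card + 1) * δ := by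
          push_cast
          rw [pow_succ]
          have h1 : 0 ≤ A ^ s.card * δ * (A - 1) := mul_nonneg (mul_nonneg hAn hδ) (by linarith)
          nlinarith [h1]

/-- The Lipschitz estimate of the product of densities on the support of the unit-scale Ursell
function: for `‖zᵢ‖ ≤ j`, `|∏ᵢ β(y₀ + proj(ε zᵢ)) - β(y₀)^j| ≤ j (1+M)^j · L ε j`. [folklore] -/
theorem tlc_abs_prod_sub_pow_le (P : DensityProfile) {L : ℝ}
    (hLip : ∀ x y, |P.β x - P.β y| ≤ L * dist x y) (hL : 0 ≤ L) {e : ℝ} (he : 0 ≤ e) {j : ℕ}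
    (y0 : T3) {z : Fin j → E3} (hz : ∀ i, ‖z i‖ ≤ j) :
    |∏ i, P.β (y0 + proj (e • z i)) - P.β y0 ^ j| ≤ j * (1 + P.M) ^ j * (L * (e * j)) := by
  have h := tlc_abs_prod_sub_prod_le (univ : Finset (Fin j)) (fun i => P.β (y0 + proj (e • z i)))
    (fun _ => P.β y0) (A := 1 + P.M) (δ := L * (e * j)) (by linarith [P.M_pos]) (by positivity)
    (fun i _ => by rw [abs_of_pos (P.pos _)]; linarith [P.le_M (y0 + proj (e • z i))])
    (fun i _ => by rw [abs_of_pos (P.pos _)]; linarith [P.le_M y0]) (fun i _ => ?_)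
  · simpa [Finset.card_univ, Fintype.card_fin] using h
  · calc |P.β (y0 + proj (e • z i)) - P.β y0| ≤ L * dist (y0 + proj (e • z i)) y0 := hLip _ _
      _ ≤ L * (e * j) := mul_le_mul_of_nonneg_left ?_ hL
    rw [dist_eq_norm, add_sub_cancel_left]
    calc ‖proj (e • z i)‖ ≤ ‖e • z i‖ := norm_proj_le _
      _ = e * ‖z i‖ := by rw [norm_smul, Real.norm_of_nonneg he]
      _ ≤ e * j := mul_le_mul_of_nonneg_left (hz i) he

/-! ### The rescaled cluster integrand `J_ε` -/

/-- `∫ domF = V_j · B_j · M^j`. [folklore] -/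
theorem tlc_integral_domF (P : DensityProfile) (j : ℕ) :
    ∫ z, domF P j z = (volume : Measure (Fin j → E3)).real (suppBox j) *
      ((hcUrsellBound (univ : Finset (Fin (j + 1))) : ℝ) * P.M ^ j) := by
  unfold domF
  rw [integral_indicator (measurableSet_suppBox j), setIntegral_const, smul_eq_mul]

/-- The integrands of `J_ε` are integrable (dominated by `domF`). [folklore] -/
theorem tlc_integrable_integrand (P : DensityProfile) (j : ℕ) (e : ℝ) (y0 : T3) :
    Integrable (fun z : Fin j → E3 => cE 1 z * ∏ i, P.β (y0 + proj (e • z i))) :=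
  (integrable_domF P j).mono' (measurable_integrand P j e y0).aestronglyMeasurable
    (ae_of_all _ fun z => by rw [Real.norm_eq_abs]; exact abs_integrand_le_domF P j e y0 z)

/-- **The Lipschitz estimate of the rescaled cluster integrand**:
`|J_ε(y₀) - b_j β(y₀)^j| ≤ V_j B_j · j (1+M)^j L ε j`, uniformly in `y₀`. [folklore] -/
theorem tlc_abs_Jint_sub_le (P : DensityProfile) {L : ℝ}
    (hLip : ∀ x y, |P.β x - P.β y| ≤ L * dist x y) (hL : 0 ≤ L) {e : ℝ} (he : 0 ≤ e) (j : ℕ)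
    (y0 : T3) :
    |Jint P e j y0 - bE j * P.β y0 ^ j| ≤ (volume : Measure (Fin j → E3)).real (suppBox j) *
      ((hcUrsellBound (univ : Finset (Fin (j + 1))) : ℝ) * (j * (1 + P.M) ^ j * (L * (e * j)))) := by
  have hM := P.M_pos
  have hB0 : 0 ≤ (hcUrsellBound (univ : Finset (Fin (j + 1))) : ℝ) := Nat.cast_nonneg _
  have hD0 : 0 ≤ (j : ℝ) * (1 + P.M) ^ j * (L * (e * j)) := by positivity
  have hF1 := tlc_integrable_integrand P j e y0
  have hF2 : Integrable (fun z : Fin j → E3 => cE 1 z * P.β y0 ^ j) := by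
    refine (tlc_integrable_integrand P j 0 y0).congr (ae_of_all _ fun z => ?_)
    simp only [zero_smul, proj_zero, add_zero, Fin.prod_const]
  have hsub : Jint P e j y0 - bE j * P.β y0 ^ j =
      ∫ z : Fin j → E3, (cE 1 z * ∏ i, P.β (y0 + proj (e • z i)) - cE 1 z * P.β y0 ^ j) := by
    rw [integral_sub hF1 hF2, Jint, bE, integral_mul_const]
  have hGi : Integrable ((suppBox j).indicator fun _ : Fin j → E3 =>
      (hcUrsellBound (univ : Finset (Fin (j + 1))) : ℝ) * (j * (1 + P.M) ^ j * (L * (e * j)))) := by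
    rw [integrable_indicator_iff (measurableSet_suppBox j)]
    exact integrableOn_const (isCompact_suppBox j).measure_lt_top.ne
  rw [hsub]
  calc |∫ z : Fin j → E3, (cE 1 z * ∏ i, P.β (y0 + proj (e • z i)) - cE 1 z * P.β y0 ^ j)|
      = ‖∫ z : Fin j → E3, (cE 1 z * ∏ i, P.β (y0 + proj (e • z i)) - cE 1 z * P.β y0 ^ j)‖ :=
        (Real.norm_eq_abs _).symm
    _ ≤ ∫ z, (suppBox j).indicator (fun _ : Fin j → E3 =>
          (hcUrsellBound (univ : Finset (Fin (j + 1))) : ℝ) * (j * (1 + P.M) ^ j * (L * (e * j)))) z :=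
        norm_integral_le_of_norm_le hGi (ae_of_all _ fun z => ?_)
    _ = (volume : Measure (Fin j → E3)).real (suppBox j) *
          ((hcUrsellBound (univ : Finset (Fin (j + 1))) : ℝ) * (j * (1 + P.M) ^ j * (L * (e * j)))) := by
        rw [integral_indicator (measurableSet_suppBox j), setIntegral_const, smul_eq_mul]
  rw [Real.norm_eq_abs, ← mul_sub]
  by_cases hc : cE 1 z = 0
  · rw [hc, zero_mul, abs_zero]
    exact Set.indicator_nonneg (fun _ _ => mul_nonneg hB0 hD0) z
  · rw [Set.indicator_of_mem (mem_suppBox_of_cE_ne_zero hc), abs_mul]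
    have hz : ∀ i, ‖z i‖ ≤ j := fun i => by
      have h := norm_le_of_cE_ne_zero zero_le_one hc i
      rwa [mul_one] at h
    exact mul_le_mul (abs_cE_le 1 z) (tlc_abs_prod_sub_pow_le P hLip hL he y0 hz) (abs_nonneg _) hB0

/-! ### Outer integrals against `g β` -/

/-- `|∫ g β F| ≤ C K` for `|g| ≤ C`, `|F| ≤ K` (`β` a probability density). [folklore] -/
theorem tlc_abs_integral_gβF_le (P : DensityProfile) {g F : T3 → ℝ} {C K : ℝ} (hgC : ∀ y, |g y| ≤ C)
    (hF : ∀ y, |F y| ≤ K) : |∫ y, g y * P.β y * F y| ≤ C * K := by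
  have hC : 0 ≤ C := (abs_nonneg _).trans (hgC 0)
  have hint : Integrable (fun y => C * K * P.β y) :=
    (integrable_of_continuous_T3 P.continuous).const_mul _
  have h : ‖∫ y, g y * P.β y * F y‖ ≤ ∫ y, C * K * P.β y := by
    refine norm_integral_le_of_norm_le hint (ae_of_all _ fun y => ?_)
    rw [Real.norm_eq_abs, abs_mul, abs_mul, abs_of_pos (P.pos y)]
    have hβ := (P.pos y).le
    calc |g y| * P.β y * |F y| ≤ C * P.β y * K :=
          mul_le_mul (mul_le_mul_of_nonneg_right (hgC y) hβ) (hF y) (abs_nonneg _) (mul_nonneg hC hβ)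
      _ = C * K * P.β y := by ring
  rw [integral_const_mul, P.integral_eq_one, mul_one, Real.norm_eq_abs] at h
  exact h

/-- The final bookkeeping: `|A I₁ + S I₃| ≤ C Θ (|A| P₁ + S' P₁ L e)` from `|I₁| ≤ C K₁`, `|I₃| ≤ C K₂`,
`|S| ≤ S'`, `K₁ ≤ Θ P₁`, `K₂ ≤ Θ P₁ L e`. [folklore] -/
theorem tlc_combine {A S S' I₁ I₃ C K₁ K₂ Θ P₁ L e : ℝ} (hC : 0 ≤ C) (h1 : |I₁| ≤ C * K₁)
    (h3 : |I₃| ≤ C * K₂) (hS : |S| ≤ S') (hK1 : K₁ ≤ Θ * P₁) (hK2 : K₂ ≤ Θ * (P₁ * L * e)) :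
    |A * I₁ + S * I₃| ≤ C * Θ * (|A| * P₁ + S' * P₁ * L * e) := by
  have hA := abs_nonneg A
  have hS' : 0 ≤ S' := (abs_nonneg S).trans hS
  calc |A * I₁ + S * I₃| ≤ |A| * |I₁| + |S| * |I₃| := (abs_add_le _ _).trans (by rw [abs_mul, abs_mul])
    _ ≤ |A| * (C * K₁) + S' * (C * K₂) :=
        add_le_add (mul_le_mul_of_nonneg_left h1 hA) (mul_le_mul hS h3 (abs_nonneg _) hS')
    _ ≤ |A| * (C * (Θ * P₁)) + S' * (C * (Θ * (P₁ * L * e))) :=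
        add_le_add (mul_le_mul_of_nonneg_left (mul_le_mul_of_nonneg_left hK1 hC) hA)
          (mul_le_mul_of_nonneg_left (mul_le_mul_of_nonneg_left hK2 hC) hS')
    _ = C * Θ * (|A| * P₁ + S' * P₁ * L * e) := by ring

/-! ### The cluster limit with a rate -/

/-- **THE CLUSTER LIMIT WITH A RATE**, absolute-value form valid for every real `σ`: with
`Θ_j = B_j V_j (j+1)²`, for every profile `P` with `L`-Lipschitz density, every `σ`, every scale `0 < ε`
with `j ε < 1/4`, every `n ≥ j + 1`, shift `s` and measurable `|g| ≤ C`,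
`|C(n-1-s, j) W^g_{ε,n}(j+1) - γ_j ∫ g β^{j+1}| ≤ C Θ_j (|C(n-1-s,j) ε^{3j} - σ^{3j}/j!| (1+M)^j + |σ³|^j (1+M)^j L ε)`.
[cite: PulvirentiTsagkarogiannis2012, §5] -/
theorem tlc_coefRate_abs :
    ∃ Θ : ℕ → ℝ, (∀ j, 0 ≤ Θ j) ∧
      ∀ (P : DensityProfile) (L : ℝ), (∀ x y, |P.β x - P.β y| ≤ L * dist x y) →
      ∀ (σ e : ℝ), 0 < e → ∀ j : ℕ, (j : ℝ) * e < 1 / 4 →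
      ∀ (n : ℕ) [NeZero n], j + 1 ≤ n → ∀ (s : ℕ) (g : T3 → ℝ), Measurable g → ∀ C : ℝ, (∀ y, |g y| ≤ C) →
      |((n - 1 - s).choose j : ℝ) * Wd P e n g (j + 1) - coefLim P σ g j| ≤
        C * Θ j * (|((n - 1 - s).choose j : ℝ) * e ^ (3 * j) - (σ ^ 3) ^ j / (j.factorial : ℝ)| * (1 + P.M) ^ j +
          |σ ^ 3| ^ j * (1 + P.M) ^ j * L * e) := by
  refine ⟨fun j => (hcUrsellBound (univ : Finset (Fin (j + 1))) : ℝ) *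
      (volume : Measure (Fin j → E3)).real (suppBox j) * ((j : ℝ) + 1) ^ 2,
    fun j => mul_nonneg (mul_nonneg (Nat.cast_nonneg _) measureReal_nonneg) (by positivity), ?_⟩
  intro P L hLip σ e he j hje n _ hjn s g hg C hgC
  dsimp only
  have hL : 0 ≤ L := tlc_lip_nonneg P hLip
  have hC : 0 ≤ C := (abs_nonneg _).trans (hgC 0)
  have hM : 0 < P.M := P.M_pos
  have hB0 : 0 ≤ (hcUrsellBound (univ : Finset (Fin (j + 1))) : ℝ) := Nat.cast_nonneg _
  have hV0 : 0 ≤ (volume : Measure (Fin j → E3)).real (suppBox j) := measureReal_nonneg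
  -- (1) the exact scaling identity and the limit coefficient
  haveI : NeZero (j + 1) := ⟨Nat.succ_ne_zero _⟩
  have hW : Wd P e n g (j + 1) = e ^ (3 * j) * ∫ y, g y * P.β y * Jint P e j y := by
    rw [Wd_eq_Wd_self P e hjn hg, Wd_self_eq_pow_mul P he hje hg hgC]
  have hcoef : coefLim P σ g j = (σ ^ 3) ^ j / (j.factorial : ℝ) * bE j * ∫ y, g y * P.β y ^ (j + 1) := by
    rw [coefLim, clusterCoeff]
  -- (2) the sup bounds on `J_ε` and on `J_ε - b_j β^j`
  have hJ : ∀ y, |Jint P e j y| ≤ (volume : Measure (Fin j → E3)).real (suppBox j) *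
      ((hcUrsellBound (univ : Finset (Fin (j + 1))) : ℝ) * P.M ^ j) :=
    fun y => (abs_Jint_le P e j y).trans (le_of_eq (tlc_integral_domF P j))
  have hJ2 : ∀ y, |Jint P e j y - bE j * P.β y ^ j| ≤ (volume : Measure (Fin j → E3)).real (suppBox j) *
      ((hcUrsellBound (univ : Finset (Fin (j + 1))) : ℝ) * (j * (1 + P.M) ^ j * (L * (e * j)))) :=
    fun y => tlc_abs_Jint_sub_le P hLip hL he.le j y
  -- (3) the outer integrals
  have hI1 : |∫ y, g y * P.β y * Jint P e j y| ≤ C * ((volume : Measure (Fin j → E3)).real (suppBox j) *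
      ((hcUrsellBound (univ : Finset (Fin (j + 1))) : ℝ) * P.M ^ j)) :=
    tlc_abs_integral_gβF_le P hgC hJ
  have hI1i : Integrable (fun y => g y * P.β y * Jint P e j y) := by
    refine (integrable_const (C * P.M * ((volume : Measure (Fin j → E3)).real (suppBox j) *
      ((hcUrsellBound (univ : Finset (Fin (j + 1))) : ℝ) * P.M ^ j)))).mono' ?_ (ae_of_all _ fun y => ?_)
    · exact ((hg.mul P.continuous.measurable).mul (measurable_Jint P e j)).aestronglyMeasurable
    · rw [Real.norm_eq_abs, abs_mul, abs_mul, abs_of_pos (P.pos y)]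
      exact mul_le_mul (mul_le_mul (hgC y) (P.le_M y) (P.pos y).le hC) (hJ y) (abs_nonneg _)
        (mul_nonneg hC hM.le)
  have hI4i : Integrable (fun y => g y * P.β y * (bE j * P.β y ^ j)) := by
    refine (integrable_const (C * P.M * (|bE j| * P.M ^ j))).mono' ?_ (ae_of_all _ fun y => ?_)
    · exact ((hg.mul P.continuous.measurable).mul
        ((P.continuous.measurable.pow_const j).const_mul _)).aestronglyMeasurable
    · rw [Real.norm_eq_abs, abs_mul, abs_mul, abs_mul, abs_of_pos (P.pos y),
        abs_of_nonneg (pow_nonneg (P.pos y).le j)]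
      exact mul_le_mul (mul_le_mul (hgC y) (P.le_M y) (P.pos y).le hC)
        (mul_le_mul_of_nonneg_left (pow_le_pow_left₀ (P.pos y).le (P.le_M y) j) (abs_nonneg _))
        (mul_nonneg (abs_nonneg _) (pow_nonneg (P.pos y).le j)) (mul_nonneg hC hM.le)
  have hdiff : (∫ y, g y * P.β y * Jint P e j y) - bE j * (∫ y, g y * P.β y ^ (j + 1)) =
      ∫ y, g y * P.β y * (Jint P e j y - bE j * P.β y ^ j) := by
    have h4 : bE j * (∫ y, g y * P.β y ^ (j + 1)) = ∫ y, g y * P.β y * (bE j * P.β y ^ j) := by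
      rw [← integral_const_mul]
      refine integral_congr_ae (ae_of_all _ fun y => ?_)
      ring
    rw [h4, ← integral_sub hI1i hI4i]
    refine integral_congr_ae (ae_of_all _ fun y => ?_)
    ring
  have hI3 : |(∫ y, g y * P.β y * Jint P e j y) - bE j * (∫ y, g y * P.β y ^ (j + 1))| ≤
      C * ((volume : Measure (Fin j → E3)).real (suppBox j) *
        ((hcUrsellBound (univ : Finset (Fin (j + 1))) : ℝ) * (j * (1 + P.M) ^ j * (L * (e * j))))) := by
    rw [hdiff]
    exact tlc_abs_integral_gβF_le P hgC hJ2
  -- (4) the split and the bookkeeping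
  have key : ((n - 1 - s).choose j : ℝ) * Wd P e n g (j + 1) - coefLim P σ g j =
      (((n - 1 - s).choose j : ℝ) * e ^ (3 * j) - (σ ^ 3) ^ j / (j.factorial : ℝ)) *
          (∫ y, g y * P.β y * Jint P e j y) +
        (σ ^ 3) ^ j / (j.factorial : ℝ) *
          ((∫ y, g y * P.β y * Jint P e j y) - bE j * (∫ y, g y * P.β y ^ (j + 1))) := by
    rw [hW, hcoef]; ring
  have hS : |(σ ^ 3) ^ j / (j.factorial : ℝ)| ≤ |σ ^ 3| ^ j := by
    rw [abs_div, abs_pow, Nat.abs_cast]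
    exact div_le_self (pow_nonneg (abs_nonneg _) _) (Nat.one_le_cast.2 (Nat.factorial_pos j))
  have hpow : P.M ^ j ≤ (1 + P.M) ^ j := pow_le_pow_left₀ hM.le (by linarith) j
  have hj1 : (1 : ℝ) ≤ ((j : ℝ) + 1) ^ 2 := one_le_pow₀ (by linarith [j.cast_nonneg (α := ℝ)])
  have hj2 : (j : ℝ) * j ≤ ((j : ℝ) + 1) ^ 2 := by nlinarith [j.cast_nonneg (α := ℝ)]
  have hK1 : (volume : Measure (Fin j → E3)).real (suppBox j) *
      ((hcUrsellBound (univ : Finset (Fin (j + 1))) : ℝ) * P.M ^ j) ≤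
      (hcUrsellBound (univ : Finset (Fin (j + 1))) : ℝ) * (volume : Measure (Fin j → E3)).real (suppBox j) *
        ((j : ℝ) + 1) ^ 2 * (1 + P.M) ^ j := by
    calc (volume : Measure (Fin j → E3)).real (suppBox j) *
        ((hcUrsellBound (univ : Finset (Fin (j + 1))) : ℝ) * P.M ^ j)
        = (hcUrsellBound (univ : Finset (Fin (j + 1))) : ℝ) * (volume : Measure (Fin j → E3)).real (suppBox j) *
            1 * P.M ^ j := by ring
      _ ≤ (hcUrsellBound (univ : Finset (Fin (j + 1))) : ℝ) * (volume : Measure (Fin j → E3)).real (suppBox j) *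
            ((j : ℝ) + 1) ^ 2 * (1 + P.M) ^ j :=
          mul_le_mul (mul_le_mul_of_nonneg_left hj1 (mul_nonneg hB0 hV0)) hpow (pow_nonneg hM.le _)
            (by positivity)
  have hK2 : (volume : Measure (Fin j → E3)).real (suppBox j) *
      ((hcUrsellBound (univ : Finset (Fin (j + 1))) : ℝ) * (j * (1 + P.M) ^ j * (L * (e * j)))) ≤
      (hcUrsellBound (univ : Finset (Fin (j + 1))) : ℝ) * (volume : Measure (Fin j → E3)).real (suppBox j) *
        ((j : ℝ) + 1) ^ 2 * ((1 + P.M) ^ j * L * e) := by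
    calc (volume : Measure (Fin j → E3)).real (suppBox j) *
        ((hcUrsellBound (univ : Finset (Fin (j + 1))) : ℝ) * (j * (1 + P.M) ^ j * (L * (e * j))))
        = ((j : ℝ) * j) * ((hcUrsellBound (univ : Finset (Fin (j + 1))) : ℝ) *
            (volume : Measure (Fin j → E3)).real (suppBox j) * ((1 + P.M) ^ j * L * e)) := by ring
      _ ≤ ((j : ℝ) + 1) ^ 2 * ((hcUrsellBound (univ : Finset (Fin (j + 1))) : ℝ) *
            (volume : Measure (Fin j → E3)).real (suppBox j) * ((1 + P.M) ^ j * L * e)) :=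
          mul_le_mul_of_nonneg_right hj2 (by positivity)
      _ = _ := by ring
  rw [key]
  exact tlc_combine hC hI1 hI3 hS hK1 hK2

/-- **THE CLUSTER LIMIT WITH A RATE** (`CoefRateNonneg`, stub `tl_coefRateNonneg`): for `0 ≤ σ`, every
profile with `L`-Lipschitz density, every scale `0 < ε` with `j ε < 1/4`, `n ≥ j + 1`, shift `s` and
measurable `|g| ≤ C`,
`|C(n-1-s, j) W^g_{ε,n}(j+1) - γ_j ∫ g β^{j+1}| ≤ C Θ_j (|C(n-1-s,j) ε^{3j} - σ^{3j}/j!| (1+M)^j + σ^{3j} (1+M)^j L ε)`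
with `Θ_j = B_j V_j (j+1)²`. [cite: PulvirentiTsagkarogiannis2012, §5] -/
theorem tl_coefRateNonneg : CoefRateNonneg := by
  unfold CoefRateNonneg
  obtain ⟨Θ, hΘ0, hΘ⟩ := tlc_coefRate_abs
  refine ⟨Θ, hΘ0, fun P L hLip σ e hσ he j hje n _ hjn s g hg C hgC => ?_⟩
  have h := hΘ P L hLip σ e he j hje n hjn s g hg C hgC
  rwa [abs_of_nonneg (pow_nonneg hσ 3)] at h

end Summit.AtomisticToContinuum.HydrodynamicLimit.Theorems.NearConstantShortTimeHL

end
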